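import Summits.HodgeConjecture.HodgeConjecture.Theorems.F0P3cStCharTSUpTrAssemblyCoreSH     -- ★-cand (A1′)-E′ (this seat): `upTransferLB_concrete_of_inputs_haarOn`; brings ★ E, ★ D, ★ (X1), ★ (N4), ★ WIF-H
import Summits.HodgeConjecture.HodgeConjecture.Theorems.F0P3cStCharTSUpTrAssemblyFold       -- ★ (F2) p852579 (this seat): `sum_fin_weylDiscrThree_mul_upSummand_eq`; brings ★ (P2)
import Summits.HodgeConjecture.HodgeConjecture.Theorems.F0P3cStCharTSUpTrClaimPRadical      -- ★ (F3) p852584 (F0P3a-p06): `hP3_radicalH`; brings ★ (P3)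
import Summits.HodgeConjecture.HodgeConjecture.Theorems.F0P3cStCharTSUpTrSlotWeight         -- ★-cand (F4) (F0P2-p01): `integrable_mul_orbitSum_slotWeight`, `integrableOn_weighted_slotWeight_mul_classOrbitalIntegral`
import Summits.HodgeConjecture.HodgeConjecture.Theorems.F0P3cStCharTSUpTrSWIFHInstArb       -- ★-cand (F7b) p852604 (LH1-p01): `finsetSum_weighted_stableOrbitalIntegral_eq_integral_of_tubeJacobians'`; brings ★ (F5) `…SWIFHInst`
import Summits.HodgeConjecture.HodgeConjecture.Theorems.F0P3cStCharTSUpTrNullSlices         -- ★-cand (F7a) (F0P3a-p05): `ae_classOrbitalIntegral_congr_of_null`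
import Summits.HodgeConjecture.HodgeConjecture.Theorems.F0P3cStCharTSUpTrWIFHFull           -- ★ (H5‴) p852571 (F0P3a-p05): `hJacNC_of_splitDock`
import Summits.HodgeConjecture.HodgeConjecture.Theorems.F0P3cStCharTSCartanAllHShapes       -- ★ (H1′) p852569 (F0P3a-p03): `exists_cartanAllH_allShapes`
import Summits.HodgeConjecture.HodgeConjecture.Theorems.F0P3cStCharTSUpTrPsiOfEmb           -- ★ (X2) p852492 (LH10-p02): `exists_psi_of_embFamily`
import Summits.HodgeConjecture.HodgeConjecture.Theorems.F0P3cStCharTSUpTrOrbInt             -- ★ (H3d) p852392 (F0P3a-p04): `exists_haar_cartanH_compactCore_eq_one`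
import Summits.HodgeConjecture.HodgeConjecture.Theorems.F0P3cStCharTSDGFieldReg            -- ★ DG-FIELD-REG (F0P3-p02): `dgFormula_conj`
import Summits.HodgeConjecture.HodgeConjecture.Theorems.F0P3cStCharTSDGFieldTwo            -- ★ DG-FIELD-TWO (F0P3-p02): `continuous_dgFormulaTwo`
import Literature.NumberTheory.Rogawski1990.EndoscopicStableTwistTransversal                -- ★ (H6a′) FILE 4 (F0P3a-p09): `exists_stableTwistAut_transversal`
import HarnessLib

/-!
# F0 · P3c · ROAD «UP-TR» brick (A1′)-F «UP-TR ASSEMBLY»: the terminal head `upTransferLB_concrete` — ★ (P1) `upTransferLB_of_concrete`'s `hconcrete` TYPE, proved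
# (Rogawski 1990 §12.5 pp. 182–183, Lemma 12.5.1)

Cell `pub/hodgecm-mathlib`, crux H413 = `stmt-HodgeConjecture-24833` (lane `--supports … --as helper`); seat LH10-p01 (g8); ROAD «UP-TR» v2∕v3 (holder F0P3-p02 (g23)), brick (A1′)
«UP-TR ASSEMBLY», FILE F of D∕E∕E′∕F.  THEOREMS ONLY; sorry-free; no definition ∕ instance ∕ notation ∕ named fact; ★-only imports; axioms TRIO.

WHAT.  `upTransferLB_concrete L v hns νHv νQv mHv mQv hcanH hcanQ μ hμu : ‹★ (P1) hconcrete›` — for every measurable stable class function `α` on `H_v^{G-reg}` with `D_H·α` locally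
bounded, every `f ∈ 𝒮(U(Φ₃)(L⁺_v))` and every `f^H` matching `f` ((4.3.1) for `Δ‴`), integrability of both sides given: `∫_G f · α^G dνQv = ∫_H f^H · α dνHv`.  PROOF = ★ E′
`upTransferLB_concrete_of_inputs_haarOn` with every binder discharged BY NAME: (F1) the closed radicals `dG`, `dH` (★ `dgFormula_conj`, `NNReal.mul_self_sqrt`); the `H`-Cartan
system ★ (H1′) `exists_cartanAllH_allShapes`; embeddings∕fibres ★ (X2) `exists_psi_of_embFamily`; the stable twist and class counts ★ (H6a′) `exists_stableTwistAut_transversal`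
(ONE `k` feeds (P3)'s `m` and SWIFH's `nT`); torus measures chosen by ★ (H3d) `exists_haar_cartanH_compactCore_eq_one` on `SH` (`0` elsewhere); conjugation families ★
`exists_conjFamily` (abelian by ★ `hab_holds`); (F2) ★ `sum_fin_weylDiscrThree_mul_upSummand_eq`; (F3) ★ `hP3_radicalH`; (F4) ★ `integrable_mul_orbitSum_slotWeight` ∕
`integrableOn_weighted_slotWeight_mul_classOrbitalIntegral`; (F5)∕(F7b) ★ `…_of_tubeJacobians'` (SWIFH instantiated, ARBITRARY `f^H` — the display carries no
measurability of `f^H`) with its socket ★ (H5‴) `hJacNC_of_splitDock` and its null-slice input ★ (F7a) `ae_classOrbitalIntegral_congr_of_null`.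
HONEST LABEL: count-neutral; UP-TR block consequents move only at the rider editions; organs 2 = 2; h413 registry untouched; print's general-α clause 3 is NOT claimed in house;
HC_CM is proved only modulo the printed citations until rung 0 closes.

## References
* [Rogawski1990] J. D. Rogawski, *Automorphic Representations of Unitary Groups in Three Variables*, Ann. of Math. Stud. 123 (1990), §12.5 pp. 182–183 (the display defining
  `α ↦ α^G`; Lemma 12.5.1 and its six-line proof), §4.9 p. 55, §4.3 (4.3.1) p. 43.
* [LanglandsShelstad1987] R. P. Langlands, D. Shelstad, *On the definition of transfer factors*, Math. Ann. 278 (1987), §1.3.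
-/

set_option autoImplicit false
-- the mandated namespace has the single-problem summit's repeated segment (`HodgeConjecture.HodgeConjecture`)
set_option linter.dupNamespace false

noncomputable section

open MeasureTheory Measure Set Filter Topology Function NumberField IsDedekindDomain Matrix
open Literature.MeasureTheory.Group
open Literature.NumberTheory.Automorphic Literature.NumberTheory.Automorphic.UnitaryGroup Literature.NumberTheory.Rogawski1990
open Literature.NumberTheory.GaloisRepresentations
open Summit.HodgeConjecture.HodgeConjecture.Cruxes.H413
open scoped ENNReal NNReal MatrixGroups Pointwise Classical

namespace Summit.HodgeConjecture.HodgeConjecture.Cruxes.H413.F0P3cStCharTSUpTrAssembly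

set_option maxHeartbeats 3200000 in
set_option synthInstance.maxHeartbeats 400000 in
-- long statement; instance-term unification on the CM local carriers (class of ★ E ∕ ★ (P1))
/-- **(A1′)-F «UP-TR ASSEMBLY» — the up-transfer identity for the locally-bounded class, unconditionally in the organ prefix's letters.**  `v` non-split (`hns`), `νHv`, `νQv` Haar,
`mHv`, `mQv` canonical, `μ` unitary.  For every measurable `α : H_v → ℂ` which is a stable class function on the `G`-regular set with `s ↦ D_H(s)·α(s)` locally bounded, every
`f ∈ 𝒮(U(Φ₃)(L⁺_v))`, every `f^H : H_v → ℂ` with `Φ^st(γ_H, f^H) = Σ Δ‴(γ_H, γ) Φ(γ, f)` ((4.3.1)), `f · α^G` and `f^H · α` integrable: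
**`∫_G f(g) α^G(g) dνQv(g) = ∫_H f^H(h) α(h) dνHv(h)`**, `α^G(g) = 𝟙[g regular] D_G(g)⁻¹ Σ_{q} 𝟙[q ↔ g] τ(q) D_H(q) κ(q, g) α(q)` (p. 183).  This is ★ (P1) `upTransferLB_of_concrete`'s
`hconcrete` binder TYPE token for token. [cite: Rogawski1990, §12.5 pp. 182–183, Lemma 12.5.1; §4.9 p. 55; §4.3 (4.3.1) p. 43] [cite: LanglandsShelstad1987, §1.3] -/
theorem upTransferLB_concrete (L : Type) [Field L] [NumberField L] [IsCMField L] (v : HeightOneSpectrum (𝓞 ↥(maximalRealSubfield L)))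
    (hns : ∀ w : PlacesOver L v, IsCMField.complexConj L • w.1 = w.1)
    [MeasurableSpace ((UnitaryGroup.cmDatum L 2 (Matrix.of fun i j : Fin 2 => if i.val + j.val + 1 = 2 then (1 : L) else 0)).Local v × (UnitaryGroup.cmDatum L 1 (Matrix.of fun i j : Fin 1 => if i.val + j.val + 1 = 1 then (1 : L) else 0)).Local v)] [BorelSpace ((UnitaryGroup.cmDatum L 2 (Matrix.of fun i j : Fin 2 => if i.val + j.val + 1 = 2 then (1 : L) else 0)).Local v × (UnitaryGroup.cmDatum L 1 (Matrix.of fun i j : Fin 1 => if i.val + j.val + 1 = 1 then (1 : L) else 0)).Local v)] [MeasurableSpace (Gqs L v)] [BorelSpace (Gqs L v)]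
    (νHv : Measure ((UnitaryGroup.cmDatum L 2 (Matrix.of fun i j : Fin 2 => if i.val + j.val + 1 = 2 then (1 : L) else 0)).Local v × (UnitaryGroup.cmDatum L 1 (Matrix.of fun i j : Fin 1 => if i.val + j.val + 1 = 1 then (1 : L) else 0)).Local v)) (νQv : Measure (Gqs L v))
    [νHv.IsHaarMeasure] [νHv.IsMulRightInvariant] [νQv.IsHaarMeasure] [νQv.IsMulRightInvariant]
    [∀ a : ((UnitaryGroup.cmDatum L 2 (Matrix.of fun i j : Fin 2 => if i.val + j.val + 1 = 2 then (1 : L) else 0)).Local v × (UnitaryGroup.cmDatum L 1 (Matrix.of fun i j : Fin 1 => if i.val + j.val + 1 = 1 then (1 : L) else 0)).Local v), MeasurableSpace (((UnitaryGroup.cmDatum L 2 (Matrix.of fun i j : Fin 2 => if i.val + j.val + 1 = 2 then (1 : L) else 0)).Local v × (UnitaryGroup.cmDatum L 1 (Matrix.of fun i j : Fin 1 => if i.val + j.val + 1 = 1 then (1 : L) else 0)).Local v) ⧸ Subgroup.centralizer ({a} : Set ((UnitaryGroup.cmDatum L 2 (Matrix.of fun i j : Fin 2 => if i.val + j.val +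 1 = 2 then (1 : L) else 0)).Local v × (UnitaryGroup.cmDatum L 1 (Matrix.of fun i j : Fin 1 => if i.val + j.val + 1 = 1 then (1 : L) else 0)).Local v)))]
    [∀ a : ((UnitaryGroup.cmDatum L 2 (Matrix.of fun i j : Fin 2 => if i.val + j.val + 1 = 2 then (1 : L) else 0)).Local v × (UnitaryGroup.cmDatum L 1 (Matrix.of fun i j : Fin 1 => if i.val + j.val + 1 = 1 then (1 : L) else 0)).Local v), BorelSpace (((UnitaryGroup.cmDatum L 2 (Matrix.of fun i j : Fin 2 => if i.val + j.val + 1 = 2 then (1 : L) else 0)).Local v × (UnitaryGroup.cmDatum L 1 (Matrix.of fun i j : Fin 1 => if i.val + j.val + 1 = 1 then (1 : L) else 0)).Local v) ⧸ Subgroup.centralizer ({a} : Set ((UnitaryGroup.cmDatum L 2 (Matrix.of fun i j : Fin 2 => if i.val + j.val + 1 = 2 then (1 : L) else 0)).Local v × (UnitaryGroup.cmDatum L 1 (Matrix.of fun i j : Fin 1 => if i.val + j.val + 1 = 1 then (1 : L) else 0)).Local v)))]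
    [∀ γ : Gqs L v, MeasurableSpace (Gqs L v ⧸ Subgroup.centralizer ({γ} : Set (Gqs L v)))]
    [∀ γ : Gqs L v, BorelSpace (Gqs L v ⧸ Subgroup.centralizer ({γ} : Set (Gqs L v)))]
    (mHv : OrbitalMeasureFamily ((UnitaryGroup.cmDatum L 2 (Matrix.of fun i j : Fin 2 => if i.val + j.val + 1 = 2 then (1 : L) else 0)).Local v × (UnitaryGroup.cmDatum L 1 (Matrix.of fun i j : Fin 1 => if i.val + j.val + 1 = 1 then (1 : L) else 0)).Local v)) (mQv : OrbitalMeasureFamily (Gqs L v))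
    (hcanH : mHv.IsCanonical (IsLocalGRegular L v) νHv)
    (hcanQ : mQv.IsCanonical (fun γ => IsRegularElt (γ.val : GL (Fin 3) (UnitaryGroup.LocalRing L v))) νQv)
    (μ : HeckeCharacter L) (hμu : μ.IsUnitary) :
    ∀ α : ((UnitaryGroup.cmDatum L 2 (Matrix.of fun i j : Fin 2 => if i.val + j.val + 1 = 2 then (1 : L) else 0)).Local v ×
        (UnitaryGroup.cmDatum L 1 (Matrix.of fun i j : Fin 1 => if i.val + j.val + 1 = 1 then (1 : L) else 0)).Local v) → ℂ,
      Measurable α →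
      Ch12Sec5.IsStableClassFunOn (IsLocalStablyConjH L v)
        {a : ((UnitaryGroup.cmDatum L 2 (Matrix.of fun i j : Fin 2 => if i.val + j.val + 1 = 2 then (1 : L) else 0)).Local v ×
          (UnitaryGroup.cmDatum L 1 (Matrix.of fun i j : Fin 1 => if i.val + j.val + 1 = 1 then (1 : L) else 0)).Local v) | IsLocalGRegular L v a} α →
      (∀ C : Set ((UnitaryGroup.cmDatum L 2 (Matrix.of fun i j : Fin 2 => if i.val + j.val + 1 = 2 then (1 : L) else 0)).Local v ×
          (UnitaryGroup.cmDatum L 1 (Matrix.of fun i j : Fin 1 => if i.val + j.val + 1 = 1 then (1 : L) else 0)).Local v), IsCompact C →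
        ∃ B : ℝ, ∀ s ∈ C, IsLocalGRegular L v s →
          ‖(((NNReal.sqrt (NNReal.sqrt ((∏ w : PlacesOver L v, IsNonarchimedeanLocalField.normAbs (w.1.adicCompletion L) (((s.1.val : GL (Fin 2) (UnitaryGroup.LocalRing L v)).val.charpoly.discr) w)) *
              (∏ w : PlacesOver L v, IsNonarchimedeanLocalField.normAbs (w.1.adicCompletion L) (((s.1.val : GL (Fin 2) (UnitaryGroup.LocalRing L v)).val.det) w))⁻¹)) : ℝ≥0) : ℝ) : ℂ) * α s‖ ≤ B) →
      ∀ f ∈ SchwartzBruhat (Gqs L v), ∀ fH : ((UnitaryGroup.cmDatum L 2 (Matrix.of fun i j : Fin 2 => if i.val + j.val + 1 = 2 then (1 : L) else 0)).Local v ×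
          (UnitaryGroup.cmDatum L 1 (Matrix.of fun i j : Fin 1 => if i.val + j.val + 1 = 1 then (1 : L) else 0)).Local v) → ℂ,
        IsLocalDeltaTransfer L (qsForm L) v
          ((finExplicitCollection L (qsForm L) μ (finExplicitDelta_conj_left_all L (qsForm L) μ) (finExplicitDelta_conj_right_all L (qsForm L) μ)) v) mHv mQv fH f →
        Integrable (fun g : Gqs L v => f g *
          (if IsRegularElt (g.val : GL (Fin 3) (UnitaryGroup.LocalRing L v)) then
            ((((NNReal.sqrt (NNReal.sqrt ((∏ w : PlacesOver L v, IsNonarchimedeanLocalField.normAbs (w.1.adicCompletion L) (((g.val : GL (Fin 3) (UnitaryGroup.LocalRing L v)).val.charpoly.discr) w)) *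
              ((∏ w : PlacesOver L v, IsNonarchimedeanLocalField.normAbs (w.1.adicCompletion L) (((g.val : GL (Fin 3) (UnitaryGroup.LocalRing L v)).val.det) w)) ^ 2)⁻¹)) : ℝ≥0) : ℝ) : ℂ))⁻¹ *
              ∑ᶠ q : Quot (IsLocalStablyConjH L v),
                (if IsLocalGRegular L v q.out ∧ IsLocalNormPair L (qsForm L) v q.out g then
                  finTau L v q.out μ *
                    (((NNReal.sqrt (NNReal.sqrt ((∏ w : PlacesOver L v, IsNonarchimedeanLocalField.normAbs (w.1.adicCompletion L) (((q.out.1.val : GL (Fin 2) (UnitaryGroup.LocalRing L v)).val.charpoly.discr) w)) *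
                      (∏ w : PlacesOver L v, IsNonarchimedeanLocalField.normAbs (w.1.adicCompletion L) (((q.out.1.val : GL (Fin 2) (UnitaryGroup.LocalRing L v)).val.det) w))⁻¹)) : ℝ≥0) : ℝ) : ℂ) *
                    ((finKappaAt L v (qsForm L) q.out g : ℤ) : ℂ) * α q.out
                else 0)
          else 0)) νQv →
        Integrable (fun h => fH h * α h) νHv →
        ∫ g, f g *
          (if IsRegularElt (g.val : GL (Fin 3) (UnitaryGroup.LocalRing L v)) then
            ((((NNReal.sqrt (NNReal.sqrt ((∏ w : PlacesOver L v, IsNonarchimedeanLocalField.normAbs (w.1.adicCompletion L) (((g.val : GL (Fin 3) (UnitaryGroup.LocalRing L v)).val.charpoly.discr) w)) *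
              ((∏ w : PlacesOver L v, IsNonarchimedeanLocalField.normAbs (w.1.adicCompletion L) (((g.val : GL (Fin 3) (UnitaryGroup.LocalRing L v)).val.det) w)) ^ 2)⁻¹)) : ℝ≥0) : ℝ) : ℂ))⁻¹ *
              ∑ᶠ q : Quot (IsLocalStablyConjH L v),
                (if IsLocalGRegular L v q.out ∧ IsLocalNormPair L (qsForm L) v q.out g then
                  finTau L v q.out μ *
                    (((NNReal.sqrt (NNReal.sqrt ((∏ w : PlacesOver L v, IsNonarchimedeanLocalField.normAbs (w.1.adicCompletion L) (((q.out.1.val : GL (Fin 2) (UnitaryGroup.LocalRing L v)).val.charpoly.discr) w)) *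
                      (∏ w : PlacesOver L v, IsNonarchimedeanLocalField.normAbs (w.1.adicCompletion L) (((q.out.1.val : GL (Fin 2) (UnitaryGroup.LocalRing L v)).val.det) w))⁻¹)) : ℝ≥0) : ℝ) : ℂ) *
                    ((finKappaAt L v (qsForm L) q.out g : ℤ) : ℂ) * α q.out
                else 0)
          else 0) ∂νQv = ∫ h, fH h * α h ∂νHv := by
  intro α hαm hαst hLB f hf fH hT hIG hIH
  letI : MeasurableSpace (Gqs L v ⧸ Subgroup.center (Gqs L v)) := borel _
  -- ### (H1′) the `H`-Cartan system, all shapes on one finset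
  obtain ⟨SH, hM, hZ, hcpt, hcov, hcovW, hcomplete, hirr, hnc, hirred⟩ := F0P3cStCharTSCartanAllHShapes.exists_cartanAllH_allShapes L v hns
  -- ### (X2) embeddings, partner maps, fibres
  obtain ⟨n, γc, eT, ψ, fib, hγc, hψ, heT, hZe, hψR, hψuniq, hfib⟩ := F0P3cStCharTSUpTrPsiOfEmb.exists_psi_of_embFamily L v hns SH hZ
  -- ### (H6a′) the stable twist `e` and the ONE class count `k`
  obtain ⟨w₀⟩ := (inferInstance : Nonempty (PlacesOver L v))
  obtain ⟨e, u, k, h1, h2, h3, h4, h5, h6, h7⟩ := exists_stableTwistAut_transversal L v w₀ (hns w₀)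
  have hclasses : ∀ T ∈ SH, ∀ s ∈ T, IsLocalGRegular L v s →
      ∃ C : Finset ((UnitaryGroup.cmDatum L 2 (Matrix.of fun i j : Fin 2 => if i.val + j.val + 1 = 2 then (1 : L) else 0)).Local v × (UnitaryGroup.cmDatum L 1 (Matrix.of fun i j : Fin 1 => if i.val + j.val + 1 = 1 then (1 : L) else 0)).Local v),
        (∀ x ∈ C, IsLocalStablyConjH L v s x) ∧ (∀ x ∈ C, ∀ y ∈ C, IsConj x y → x = y) ∧ (∀ y, IsLocalStablyConjH L v s y → ∃ x ∈ C, IsConj y x) ∧ C.card = k T := by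
    intro T hT s hs hreg
    obtain ⟨C, hC1, hC2, hC3, hC4, -⟩ := h7 T (hZ T hT) s hs hreg
    exact ⟨C, hC1, hC2, hC3, hC4⟩
  have hk : ∀ T : ↥SH, (k (T : Subgroup ((UnitaryGroup.cmDatum L 2 (Matrix.of fun i j : Fin 2 => if i.val + j.val + 1 = 2 then (1 : L) else 0)).Local v × (UnitaryGroup.cmDatum L 1 (Matrix.of fun i j : Fin 1 => if i.val + j.val + 1 = 1 then (1 : L) else 0)).Local v)) = 1 ∧ ∀ s : ↥(T : Subgroup ((UnitaryGroup.cmDatum L 2 (Matrix.of fun i j : Fin 2 => if i.val + j.val + 1 = 2 then (1 : L) else 0)).Local v × (UnitaryGroup.cmDatum L 1 (Matrix.of fun i j : Fin 1 => if i.val + j.val + 1 = 1 then (1 : L) else 0)).Local v)), IsLocalGRegular L v (s : ((UnitaryGroup.cmDatum L 2 (Matrix.of fun i j : Fin 2 => if i.val + j.val + 1 = 2 then (1 : L) else 0)).Local v × (UnitaryGroup.cmDatum L 1 (Matrix.of fun i j : Fin 1 => if i.val + j.val + 1 = 1 then (1 : L) else 0)).Local v)) →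
          {c : ConjClasses ((UnitaryGroup.cmDatum L 2 (Matrix.of fun i j : Fin 2 => if i.val + j.val + 1 = 2 then (1 : L) else 0)).Local v × (UnitaryGroup.cmDatum L 1 (Matrix.of fun i j : Fin 1 => if i.val + j.val + 1 = 1 then (1 : L) else 0)).Local v) | IsLocalStablyConjH L v (s : ((UnitaryGroup.cmDatum L 2 (Matrix.of fun i j : Fin 2 => if i.val + j.val + 1 = 2 then (1 : L) else 0)).Local v × (UnitaryGroup.cmDatum L 1 (Matrix.of fun i j : Fin 1 => if i.val + j.val + 1 = 1 then (1 : L) else 0)).Local v)) (Quotient.out c)} = {ConjClasses.mk (s : ((UnitaryGroup.cmDatum L 2 (Matrix.of fun i j : Fin 2 => if i.val + j.val + 1 = 2 then (1 : L) else 0)).Local v × (UnitaryGroup.cmDatum L 1 (Matrix.of fun i j : Fin 1 => if i.val + j.val + 1 = 1 then (1 : L) else 0)).Local v))} ∧ IsConj (s : ((UnitaryGroup.cmDatum L 2 (Matrix.of fun i j : Fin 2 => if i.val + j.val + 1 = 2 then (1 : L) else 0)).Local v × (UnitaryGroup.cmDatum L 1 (Matrix.of fun i j : Fin 1 => if i.val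 + j.val + 1 = 1 then (1 : L) else 0)).Local v)) (e (s : ((UnitaryGroup.cmDatum L 2 (Matrix.of fun i j : Fin 2 => if i.val + j.val + 1 = 2 then (1 : L) else 0)).Local v × (UnitaryGroup.cmDatum L 1 (Matrix.of fun i j : Fin 1 => if i.val + j.val + 1 = 1 then (1 : L) else 0)).Local v)))) ∨
        (k (T : Subgroup ((UnitaryGroup.cmDatum L 2 (Matrix.of fun i j : Fin 2 => if i.val + j.val + 1 = 2 then (1 : L) else 0)).Local v × (UnitaryGroup.cmDatum L 1 (Matrix.of fun i j : Fin 1 => if i.val + j.val + 1 = 1 then (1 : L) else 0)).Local v)) = 2 ∧ ∀ s : ↥(T : Subgroup ((UnitaryGroup.cmDatum L 2 (Matrix.of fun i j : Fin 2 => if i.val + j.val + 1 = 2 then (1 : L) else 0)).Local v × (UnitaryGroup.cmDatum L 1 (Matrix.of fun i j : Fin 1 => if i.val + j.val + 1 = 1 then (1 : L) else 0)).Local v)), IsLocalGRegular L v (s : ((UnitaryGroup.cmDatum L 2 (Matrix.of fun i j : Fin 2 => if i.val + j.val + 1 = 2 then (1 : L) else 0)).Local v × (UnitaryGroup.cmDatum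 L 1 (Matrix.of fun i j : Fin 1 => if i.val + j.val + 1 = 1 then (1 : L) else 0)).Local v)) →
          {c : ConjClasses ((UnitaryGroup.cmDatum L 2 (Matrix.of fun i j : Fin 2 => if i.val + j.val + 1 = 2 then (1 : L) else 0)).Local v × (UnitaryGroup.cmDatum L 1 (Matrix.of fun i j : Fin 1 => if i.val + j.val + 1 = 1 then (1 : L) else 0)).Local v) | IsLocalStablyConjH L v (s : ((UnitaryGroup.cmDatum L 2 (Matrix.of fun i j : Fin 2 => if i.val + j.val + 1 = 2 then (1 : L) else 0)).Local v × (UnitaryGroup.cmDatum L 1 (Matrix.of fun i j : Fin 1 => if i.val + j.val + 1 = 1 then (1 : L) else 0)).Local v)) (Quotient.out c)} = {ConjClasses.mk (s : ((UnitaryGroup.cmDatum L 2 (Matrix.of fun i j : Fin 2 => if i.val + j.val + 1 = 2 then (1 : L) else 0)).Local v × (UnitaryGroup.cmDatum L 1 (Matrix.of fun i j : Fin 1 => if i.val + j.val + 1 = 1 then (1 : L) else 0)).Local v)), ConjClasses.mk (e (s : ((UnitaryGroup.cmDatum L 2 (Matrix.of fun i j : Fin 2 => if i.val + j.val + 1 =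 2 then (1 : L) else 0)).Local v × (UnitaryGroup.cmDatum L 1 (Matrix.of fun i j : Fin 1 => if i.val + j.val + 1 = 1 then (1 : L) else 0)).Local v)))} ∧ ¬ IsConj (s : ((UnitaryGroup.cmDatum L 2 (Matrix.of fun i j : Fin 2 => if i.val + j.val + 1 = 2 then (1 : L) else 0)).Local v × (UnitaryGroup.cmDatum L 1 (Matrix.of fun i j : Fin 1 => if i.val + j.val + 1 = 1 then (1 : L) else 0)).Local v)) (e (s : ((UnitaryGroup.cmDatum L 2 (Matrix.of fun i j : Fin 2 => if i.val + j.val + 1 = 2 then (1 : L) else 0)).Local v × (UnitaryGroup.cmDatum L 1 (Matrix.of fun i j : Fin 1 => if i.val + j.val + 1 = 1 then (1 : L) else 0)).Local v)))) := by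
    intro T
    rcases h6 (T : Subgroup ((UnitaryGroup.cmDatum L 2 (Matrix.of fun i j : Fin 2 => if i.val + j.val + 1 = 2 then (1 : L) else 0)).Local v × (UnitaryGroup.cmDatum L 1 (Matrix.of fun i j : Fin 1 => if i.val + j.val + 1 = 1 then (1 : L) else 0)).Local v)) (hZ T.1 T.2) with ⟨hk1, h⟩ | ⟨hk2, h⟩
    · exact Or.inl ⟨hk1, fun s hs => ⟨(h s.1 s.2 hs).2, (h s.1 s.2 hs).1⟩⟩
    · exact Or.inr ⟨hk2, fun s hs => ⟨(h s.1 s.2 hs).2, (h s.1 s.2 hs).1⟩⟩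
  -- ### the torus measures: THE compact-core-normalised Haar measure on each member of `SH` (★ (H3d)), `0` elsewhere
  have htex : ∀ T : Subgroup ((UnitaryGroup.cmDatum L 2 (Matrix.of fun i j : Fin 2 => if i.val + j.val + 1 = 2 then (1 : L) else 0)).Local v × (UnitaryGroup.cmDatum L 1 (Matrix.of fun i j : Fin 1 => if i.val + j.val + 1 = 1 then (1 : L) else 0)).Local v), ∃ t : Measure ↥T, T ∈ SH → t.IsHaarMeasure ∧ t.IsInvInvariant ∧ t (compactCore ↥T) = 1 := by
    intro T
    by_cases hT : T ∈ SH
    · obtain ⟨γ₀, hγ₀, hTe⟩ := hZ T hT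
      obtain ⟨t, ht1, ht2, ht3⟩ := F0P3cStCharTSUpTrOrbInt.exists_haar_cartanH_compactCore_eq_one hγ₀ hTe
      exact ⟨t, fun _ => ⟨ht1, ht2, ht3⟩⟩
    · exact ⟨0, fun h => absurd h hT⟩
  choose tH htHpkg using htex
  have htHh : ∀ T ∈ SH, (tH T).IsHaarMeasure := fun T hT => (htHpkg T hT).1
  have htHinv : ∀ T ∈ SH, (tH T).IsInvInvariant := fun T hT => (htHpkg T hT).2.1
  have htH : ∀ T ∈ SH, tH T (compactCore ↥T) = 1 := fun T hT => (htHpkg T hT).2.2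
  -- ### conjugation families of the (abelian) members
  have hΦex : ∀ T : ↥SH, ∃ Φ : (((UnitaryGroup.cmDatum L 2 (Matrix.of fun i j : Fin 2 => if i.val + j.val + 1 = 2 then (1 : L) else 0)).Local v × (UnitaryGroup.cmDatum L 1 (Matrix.of fun i j : Fin 1 => if i.val + j.val + 1 = 1 then (1 : L) else 0)).Local v) ⧸ (T : Subgroup ((UnitaryGroup.cmDatum L 2 (Matrix.of fun i j : Fin 2 => if i.val + j.val + 1 = 2 then (1 : L) else 0)).Local v × (UnitaryGroup.cmDatum L 1 (Matrix.of fun i j : Fin 1 => if i.val + j.val + 1 = 1 then (1 : L) else 0)).Local v))) × ↥(T : Subgroup ((UnitaryGroup.cmDatum L 2 (Matrix.of fun i j : Fin 2 => if i.val + j.val + 1 = 2 then (1 : L) else 0)).Local v × (UnitaryGroup.cmDatum L 1 (Matrix.of fun i j : Fin 1 => if i.val + j.val + 1 = 1 then (1 : L) else 0)).Local v)) → ((UnitaryGroup.cmDatum L 2 (Matrix.of fun i j : Fin 2 => if i.val + j.val + 1 = 2 then (1 : L) else 0)).Local v × (UnitaryGroup.cmDatum L 1 (Matrix.of fun i j :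 Fin 1 => if i.val + j.val + 1 = 1 then (1 : L) else 0)).Local v),
      ∀ (x : ((UnitaryGroup.cmDatum L 2 (Matrix.of fun i j : Fin 2 => if i.val + j.val + 1 = 2 then (1 : L) else 0)).Local v × (UnitaryGroup.cmDatum L 1 (Matrix.of fun i j : Fin 1 => if i.val + j.val + 1 = 1 then (1 : L) else 0)).Local v)) (t : ↥(T : Subgroup ((UnitaryGroup.cmDatum L 2 (Matrix.of fun i j : Fin 2 => if i.val + j.val + 1 = 2 then (1 : L) else 0)).Local v × (UnitaryGroup.cmDatum L 1 (Matrix.of fun i j : Fin 1 => if i.val + j.val + 1 = 1 then (1 : L) else 0)).Local v))), Φ (QuotientGroup.mk x, t) = x * t * x⁻¹ := by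
    intro T
    obtain ⟨γ₀, hγ₀, hTe⟩ := hZ T.1 T.2
    exact F0P3cStCharTSWeylHypMeasure.exists_conjFamily (T : Subgroup ((UnitaryGroup.cmDatum L 2 (Matrix.of fun i j : Fin 2 => if i.val + j.val + 1 = 2 then (1 : L) else 0)).Local v × (UnitaryGroup.cmDatum L 1 (Matrix.of fun i j : Fin 1 => if i.val + j.val + 1 = 1 then (1 : L) else 0)).Local v)) (F0P3cStCharTSUpTrWIFHInst.hab_holds hγ₀ hTe)
  choose Φ hΦ using hΦex
  -- ### scalars: `f` measurable (locally constant), `D_H` measurable (continuous closed form)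
  have hfm : Measurable f := ((mem_schwartzBruhat_iff).1 hf).1.continuous.measurable
  have hdHm : Measurable fun s : ((UnitaryGroup.cmDatum L 2 (Matrix.of fun i j : Fin 2 => if i.val + j.val + 1 = 2 then (1 : L) else 0)).Local v × (UnitaryGroup.cmDatum L 1 (Matrix.of fun i j : Fin 1 => if i.val + j.val + 1 = 1 then (1 : L) else 0)).Local v) => ((NNReal.sqrt (NNReal.sqrt ((∏ w : PlacesOver L v, IsNonarchimedeanLocalField.normAbs (w.1.adicCompletion L) (((s.1.val : GL (Fin 2) (UnitaryGroup.LocalRing L v)).val.charpoly.discr) w)) * (∏ w : PlacesOver L v, IsNonarchimedeanLocalField.normAbs (w.1.adicCompletion L) (((s.1.val : GL (Fin 2) (UnitaryGroup.LocalRing L v)).val.det) w))⁻¹)) : ℝ≥0) : ℝ) :=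
    ((F0P3cStCharTSDGFieldTwo.continuous_dgFormulaTwo L v (Matrix.of fun i j : Fin 2 => if i.val + j.val + 1 = 2 then (1 : L) else 0)).comp continuous_fst).measurable
  -- ### (F5): Weyl side on `H_v` (SWIFH instantiated), with the (H5‴) socket and the per-member instances
  haveI hHi : ∀ T : ↥SH, (tH (T : Subgroup ((UnitaryGroup.cmDatum L 2 (Matrix.of fun i j : Fin 2 => if i.val + j.val + 1 = 2 then (1 : L) else 0)).Local v × (UnitaryGroup.cmDatum L 1 (Matrix.of fun i j : Fin 1 => if i.val + j.val + 1 = 1 then (1 : L) else 0)).Local v))).IsHaarMeasure := fun T => htHh T.1 T.2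
  haveI hIi : ∀ T : ↥SH, (tH (T : Subgroup ((UnitaryGroup.cmDatum L 2 (Matrix.of fun i j : Fin 2 => if i.val + j.val + 1 = 2 then (1 : L) else 0)).Local v × (UnitaryGroup.cmDatum L 1 (Matrix.of fun i j : Fin 1 => if i.val + j.val + 1 = 1 then (1 : L) else 0)).Local v))).IsInvInvariant := fun T => htHinv T.1 T.2
  have hSW := F0P3cStCharTSUpTrSWIFHInstArb.finsetSum_weighted_stableOrbitalIntegral_eq_integral_of_tubeJacobians' hns νHv hcanH SH hZ hcovW hnc Φ hΦ
    tH htHh htHinv htH (fun s : ((UnitaryGroup.cmDatum L 2 (Matrix.of fun i j : Fin 2 => if i.val + j.val + 1 = 2 then (1 : L) else 0)).Local v × (UnitaryGroup.cmDatum L 1 (Matrix.of fun i j : Fin 1 => if i.val + j.val + 1 = 1 then (1 : L) else 0)).Local v) => ((NNReal.sqrt (NNReal.sqrt ((∏ w : PlacesOver L v, IsNonarchimedeanLocalField.normAbs (w.1.adicCompletion L) (((s.1.val : GL (Fin 2) (UnitaryGroup.LocalRing L v)).val.charpoly.discr) w)) * (∏ w : PlacesOver L v, IsNonarchimedeanLocalField.normAbs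 (w.1.adicCompletion L) (((s.1.val : GL (Fin 2) (UnitaryGroup.LocalRing L v)).val.det) w))⁻¹)) : ℝ≥0) : ℝ)) (fun _ => rfl)
    (fun T hTnc => by
      exact F0P3cStCharTSUpTrWIFHFull.hJacNC_of_splitDock hns νHv SH hZ hcpt Φ hΦ (fun T => tH (T : Subgroup ((UnitaryGroup.cmDatum L 2 (Matrix.of fun i j : Fin 2 => if i.val + j.val + 1 = 2 then (1 : L) else 0)).Local v × (UnitaryGroup.cmDatum L 1 (Matrix.of fun i j : Fin 1 => if i.val + j.val + 1 = 1 then (1 : L) else 0)).Local v))) (fun T => htH T.1 T.2) T hTnc)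
    e (h5 νHv) (fun a _ => h2 a) h4 k hk
    (fun {N} hNm hN0 T hTm => F0P3cStCharTSUpTrNullSlices.ae_classOrbitalIntegral_congr_of_null hns νHv hcanH SH hZ hcpt hcovW hnc Φ hΦ
      (fun T => tH (T : Subgroup ((UnitaryGroup.cmDatum L 2 (Matrix.of fun i j : Fin 2 => if i.val + j.val + 1 = 2 then (1 : L) else 0)).Local v × (UnitaryGroup.cmDatum L 1 (Matrix.of fun i j : Fin 1 => if i.val + j.val + 1 = 1 then (1 : L) else 0)).Local v))) (fun T => htH T.1 T.2) hNm hN0 ⟨T, hTm⟩)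
    fH α hαm hαst hIH
  -- ### E′ with every binder named
  exact F0P3cStCharTSUpTrAssemblyCoreSH.upTransferLB_concrete_of_inputs_haarOn L v hns νHv νQv mHv hcanQ μ
    (fun g : Gqs L v => ((NNReal.sqrt (NNReal.sqrt ((∏ w : PlacesOver L v, IsNonarchimedeanLocalField.normAbs (w.1.adicCompletion L) (((g.val : GL (Fin 3) (UnitaryGroup.LocalRing L v)).val.charpoly.discr) w)) * ((∏ w : PlacesOver L v, IsNonarchimedeanLocalField.normAbs (w.1.adicCompletion L) (((g.val : GL (Fin 3) (UnitaryGroup.LocalRing L v)).val.det) w)) ^ 2)⁻¹)) : ℝ≥0) : ℝ))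
    (fun h g => F0P3cStCharTSDGFieldReg.dgFormula_conj L v g h)
    (fun t _ => by rw [← NNReal.coe_mul, NNReal.mul_self_sqrt])
    (fun s : ((UnitaryGroup.cmDatum L 2 (Matrix.of fun i j : Fin 2 => if i.val + j.val + 1 = 2 then (1 : L) else 0)).Local v × (UnitaryGroup.cmDatum L 1 (Matrix.of fun i j : Fin 1 => if i.val + j.val + 1 = 1 then (1 : L) else 0)).Local v) => ((NNReal.sqrt (NNReal.sqrt ((∏ w : PlacesOver L v, IsNonarchimedeanLocalField.normAbs (w.1.adicCompletion L) (((s.1.val : GL (Fin 2) (UnitaryGroup.LocalRing L v)).val.charpoly.discr) w)) * (∏ w : PlacesOver L v, IsNonarchimedeanLocalField.normAbs (w.1.adicCompletion L) (((s.1.val : GL (Fin 2) (UnitaryGroup.LocalRing L v)).val.det) w))⁻¹)) : ℝ≥0) : ℝ))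
    SH (fun T => ((((T.subgroupOf (Subgroup.normalizer (T : Set ((UnitaryGroup.cmDatum L 2 (Matrix.of fun i j : Fin 2 => if i.val + j.val + 1 = 2 then (1 : L) else 0)).Local v × (UnitaryGroup.cmDatum L 1 (Matrix.of fun i j : Fin 1 => if i.val + j.val + 1 = 1 then (1 : L) else 0)).Local v)))).index : ℂ))⁻¹ * ((k T : ℂ))⁻¹)) n γc hγc eT heT ψ hψ fib hfib tH htHh htH α f hfm fH
    (F0P3cStCharTSUpTrClaimPRadical.hP3_radicalH L v hns μ α hαst SH hZ hcomplete hirred k hclasses n ψ hψR hψuniq fib hfib)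
    (fun T hT i => F0P3cStCharTSUpTrSlotWeight.integrable_mul_orbitSum_slotWeight L v hns νQv (hγc T hT i) (eT T i) (heT T hT i) μ hμu
      (fun g : Gqs L v => ((NNReal.sqrt (NNReal.sqrt ((∏ w : PlacesOver L v, IsNonarchimedeanLocalField.normAbs (w.1.adicCompletion L) (((g.val : GL (Fin 3) (UnitaryGroup.LocalRing L v)).val.charpoly.discr) w)) * ((∏ w : PlacesOver L v, IsNonarchimedeanLocalField.normAbs (w.1.adicCompletion L) (((g.val : GL (Fin 3) (UnitaryGroup.LocalRing L v)).val.det) w)) ^ 2)⁻¹)) : ℝ≥0) : ℝ)) (fun _ => rfl) (fun s : ((UnitaryGroup.cmDatum L 2 (Matrix.of fun i j : Fin 2 => if i.val + j.val + 1 = 2 then (1 : L) else 0)).Local v × (UnitaryGroup.cmDatum L 1 (Matrix.of fun i j : Fin 1 => if i.val + j.val + 1 = 1 then (1 : L) else 0)).Local v) => ((NNReal.sqrt (NNReal.sqrt ((∏ w : PlacesOver L v, IsNonarchimedeanLocalField.normAbs (w.1.adicCompletion L) (((s.1.val : GL (Fin 2) (UnitaryGroup.LocalRing L v)).val.charpoly.discr)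 w)) * (∏ w : PlacesOver L v, IsNonarchimedeanLocalField.normAbs (w.1.adicCompletion L) (((s.1.val : GL (Fin 2) (UnitaryGroup.LocalRing L v)).val.det) w))⁻¹)) : ℝ≥0) : ℝ)) hdHm α hαm hLB f hf)
    (fun T hT i => by
      haveI := htHh T hT
      exact F0P3cStCharTSUpTrSlotWeight.integrableOn_weighted_slotWeight_mul_classOrbitalIntegral L v hns νQv hcanQ (tH T) (htH T hT) (hγc T hT i) (eT T i) (heT T hT i) μ hμu
        (fun g : Gqs L v => ((NNReal.sqrt (NNReal.sqrt ((∏ w : PlacesOver L v, IsNonarchimedeanLocalField.normAbs (w.1.adicCompletion L) (((g.val : GL (Fin 3) (UnitaryGroup.LocalRing L v)).val.charpoly.discr) w)) * ((∏ w : PlacesOver L v, IsNonarchimedeanLocalField.normAbs (w.1.adicCompletion L) (((g.val : GL (Fin 3) (UnitaryGroup.LocalRing L v)).val.det) w)) ^ 2)⁻¹)) : ℝ≥0) : ℝ)) (fun _ => rfl) (fun s : ((UnitaryGroup.cmDatum L 2 (Matrix.of fun i j : Fin 2 => if i.val + j.val + 1 = 2 then (1 : L) else 0)).Local v × (UnitaryGroup.cmDatum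 L 1 (Matrix.of fun i j : Fin 1 => if i.val + j.val + 1 = 1 then (1 : L) else 0)).Local v) => ((NNReal.sqrt (NNReal.sqrt ((∏ w : PlacesOver L v, IsNonarchimedeanLocalField.normAbs (w.1.adicCompletion L) (((s.1.val : GL (Fin 2) (UnitaryGroup.LocalRing L v)).val.charpoly.discr) w)) * (∏ w : PlacesOver L v, IsNonarchimedeanLocalField.normAbs (w.1.adicCompletion L) (((s.1.val : GL (Fin 2) (UnitaryGroup.LocalRing L v)).val.det) w))⁻¹)) : ℝ≥0) : ℝ)) hdHm α hαm hLB f hf)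
    (fun T hTm s hs => F0P3cStCharTSUpTrAssemblyFold.sum_fin_weylDiscrThree_mul_upSummand_eq L v μ _ _ mQv f hns mHv fH hT (γc T) (eT T) (ψ T)
      (hψ T hTm) (hψR T hTm) (hψuniq T hTm) α s hs)
    hSW

end Summit.HodgeConjecture.HodgeConjecture.Cruxes.H413.F0P3cStCharTSUpTrAssembly

end
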